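import Mathlib
import HarnessLib
import Literature.Analysis.FluidPDE.NewtonPotentialHolder
import Literature.Analysis.FluidPDE.TaoEnstrophyLocalisationProofs
import Summits.NavierStokesRegularity.NavierStokesRegularity.Theorems.ChiralWindowDoorDefs
import Summits.NavierStokesRegularity.NavierStokesRegularity.Theorems.CriticalFluxDoorDefs
import Summits.NavierStokesRegularity.NavierStokesRegularity.Theorems.ChiralWindowDoorClassDerivDecay
import Summits.NavierStokesRegularity.NavierStokesRegularity.Theorems.ChiralWindowDoorLambda
import Summits.NavierStokesRegularity.NavierStokesRegularity.Theorems.CriticalFluxDoorLambdaDecay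

/-!
# Door S21-C «CriticalFluxDoor» — `Λ` COMMUTES WITH DERIVATIVES and PRESERVES DIVERGENCE-FREENESS (F3 plumbing E6, E8)

Door S21-C of nsreg-p1's local Type-I door family (`HOME/ns-regularity-ideate-p1/ROUND-20.md`; DESIGN-ONLY, route NOT born).
Two ingredients of the windowed critical-energy budget (F3-DERIVATION §1: the dissipation term `∑ᵢ Q(a,∂ᵢv)` needs
`∂ᵢΛv = Λ∂ᵢv`; the gauge-freeness of the pressure flux needs `div Λv = 0`):

* E6 `integrable_derivDom`, `norm_integrand_le_derivDom` (the `x`-uniform majorant `…CriticalFluxDoorDefs.derivDom`),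
  `hasFDerivAt_fracLapHalf` (`Λ` of a `C³` field with bounded `f, Df, D²f, D³f` is differentiable, `DΛf` = the `CLM`-valued
  kernel integral — Mathlib `hasFDerivAt_integral_of_dominated_of_fderiv_le`), `integrable_derivIntegrand`,
  `fderiv_fracLapHalf_apply` (**`∂_e(Λf) = Λ(∂_e f)`**), `fderiv_fracLapHalf_slice_apply` (door-class slices, orders 0–3 of
  `exists_classical_scaleInvariantBounds_of_class`);
* E8 `isDivFree_fracLapHalf` (**`div Λf = 0`** for divergence-free `C³_b` fields: the trace `Literature…traceCLM` passes
  through the Bochner integral), `isDivFree_fracLapHalf_slice`.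

Proofs: nsreg-p1 g17 (`r20/LambdaDecay.lean` v5 §§E6, E8, farm rc 0), landed by nsreg-p6 g13 (trace functional = the tree's
`Literature.Analysis.FluidPDE.traceCLM`).  Seat nsreg-p6 g13 (THEOREMS-ONLY door sequels, DIRECTOR-NS g8 #32 (2)/#36).  WHAT THIS IS NOT: not NS regularity (Clay A); kernel calculus only; no route is opened.
-/

noncomputable section

-- the summit and its single sub-problem share the name (CONVENTIONS §1), as in every Theorems file
set_option linter.dupNamespace false

namespace Summit.NavierStokesRegularity.NavierStokesRegularity.Theorems.CriticalFluxDoorLambdaDeriv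

open MeasureTheory Metric Set Filter Topology Function
open Literature.Analysis Literature.Analysis.FluidPDE
open Summit.NavierStokesRegularity.NavierStokesRegularity.Theorems.ChiralWindowDoorDefs
open Summit.NavierStokesRegularity.NavierStokesRegularity.Theorems.CriticalFluxDoorDefs
open Summit.NavierStokesRegularity.NavierStokesRegularity.Theorems.ChiralWindowDoorClassDerivDecay
open Summit.NavierStokesRegularity.NavierStokesRegularity.Theorems.ChiralWindowDoorLambda
  (integrable_fracLapHalf_integrand_of_contDiff lamK_mul_sq_le)
open Summit.NavierStokesRegularity.NavierStokesRegularity.Theorems.CriticalFluxDoorLambdaDecay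

/-! ## E6 — `Λ` COMMUTES WITH DERIVATIVES (`∂_e Λf = Λ ∂_e f`; ingredient of F2/F3 of S21-C and of S20's B-line):
differentiation under the integral sign with the `x`-uniform majorant `derivDom`. -/
/-- The majorant `derivDom M₁ M₃` (`…CriticalFluxDoorDefs`) is integrable on `ℝ³`. -/
theorem integrable_derivDom (M₁ M₃ : ℝ) : Integrable (derivDom M₁ M₃) := by
  have h1 : Integrable (fun z => (ball (0 : EuclideanSpace ℝ (Fin 3)) 1).indicator
      (fun z => (1 / Real.pi ^ 2 * (2 * M₃)) * ‖z‖ ^ (-(2 : ℝ))) z) := by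
    rw [integrable_indicator_iff measurableSet_ball]
    exact (NewtonPotentialHolder.integrableOn_ball_norm_rpow_neg (by norm_num) 1).const_mul _
  have h2 : Integrable (fun z => (ball (0 : EuclideanSpace ℝ (Fin 3)) 1)ᶜ.indicator
      (fun z => (1 / Real.pi ^ 2 * (4 * M₁)) * ‖z‖ ^ (-(4 : ℝ))) z) := by
    rw [integrable_indicator_iff measurableSet_ball.compl]
    exact (NewtonPotentialHolder.integrableOn_compl_ball_norm_rpow_neg (by norm_num) one_pos).const_mul _
  exact h1.add h2

/-- The derivative integrand is dominated by `derivDom`, uniformly in the base point. -/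
theorem norm_integrand_le_derivDom {F : Type*} [NormedAddCommGroup F] [NormedSpace ℝ F] {g : EuclideanSpace ℝ (Fin 3) → F}
    (hg : ContDiff ℝ 2 g) {M₁ M₃ : ℝ} (h1 : ∀ y, ‖g y‖ ≤ M₁) (h3i : ∀ y, ‖iteratedFDeriv ℝ 2 g y‖ ≤ M₃)
    (x z : EuclideanSpace ℝ (Fin 3)) : ‖lamK z • ((2 : ℝ) • g x - g (x + z) - g (x - z))‖ ≤ derivDom M₁ M₃ z := by
  have h3 : ∀ y, ‖fderiv ℝ (fderiv ℝ g) y‖ ≤ M₃ := fun y => by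
    rw [← norm_iteratedFDeriv_one (𝕜 := ℝ) (fderiv ℝ g), norm_iteratedFDeriv_fderiv]; exact h3i y
  have hM₁ : 0 ≤ M₁ := le_trans (norm_nonneg (g 0)) (h1 0)
  have hM₃ : 0 ≤ M₃ := le_trans (norm_nonneg (iteratedFDeriv ℝ 2 g 0)) (h3i 0)
  rw [norm_smul, Real.norm_eq_abs, abs_of_nonneg (lamK_nonneg z)]
  have hn1 : ∀ z, 0 ≤ (ball (0 : EuclideanSpace ℝ (Fin 3)) 1).indicator (fun z => (1 / Real.pi ^ 2 * (2 * M₃)) * ‖z‖ ^ (-(2 : ℝ))) z := by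
    intro z; by_cases hz : z ∈ ball (0 : EuclideanSpace ℝ (Fin 3)) 1
    · rw [indicator_of_mem hz]; exact mul_nonneg (by positivity) (Real.rpow_nonneg (norm_nonneg _) _)
    · rw [indicator_of_notMem hz]
  have hn2 : ∀ z, 0 ≤ (ball (0 : EuclideanSpace ℝ (Fin 3)) 1)ᶜ.indicator (fun z => (1 / Real.pi ^ 2 * (4 * M₁)) * ‖z‖ ^ (-(4 : ℝ))) z := by
    intro z; by_cases hz : z ∈ (ball (0 : EuclideanSpace ℝ (Fin 3)) 1)ᶜ
    · rw [indicator_of_mem hz]; exact mul_nonneg (by positivity) (Real.rpow_nonneg (norm_nonneg _) _)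
    · rw [indicator_of_notMem hz]
  unfold derivDom
  by_cases hz : ‖z‖ < 1
  · have hzb : z ∈ ball (0 : EuclideanSpace ℝ (Fin 3)) 1 := mem_ball_zero_iff.2 hz
    have hsd : ‖(2 : ℝ) • g x - g (x + z) - g (x - z)‖ ≤ 2 * M₃ * ‖z‖ ^ 2 :=
      norm_secondDiff_le_local hg (r := 1) (fun y _ => h3 y) hz.le
    have h2 : lamK z * ‖(2 : ℝ) • g x - g (x + z) - g (x - z)‖ ≤
        (1 / Real.pi ^ 2 * (2 * M₃)) * ‖z‖ ^ (-(2 : ℝ)) := by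
      have := mul_le_mul_of_nonneg_left hsd (lamK_nonneg z)
      rw [show 2 * M₃ * ‖z‖ ^ 2 = (2 * M₃) * ‖z‖ ^ 2 by ring] at this
      exact this.trans (lamK_mul_sq_le (by positivity) z)
    rw [indicator_of_mem hzb]
    linarith [hn2 z]
  · push Not at hz
    have hzpos : 0 < ‖z‖ := one_pos.trans_le hz
    have hzc : z ∈ (ball (0 : EuclideanSpace ℝ (Fin 3)) 1)ᶜ := by rw [mem_compl_iff, mem_ball_zero_iff]; exact not_lt.2 hz
    have htri : ‖(2 : ℝ) • g x - g (x + z) - g (x - z)‖ ≤ 4 * M₁ := by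
      have e1 := norm_sub_le ((2 : ℝ) • g x - g (x + z)) (g (x - z))
      have e2 := norm_sub_le ((2 : ℝ) • g x) (g (x + z))
      have e3 : ‖(2 : ℝ) • g x‖ = 2 * ‖g x‖ := by
        rw [norm_smul, Real.norm_eq_abs, abs_of_pos (by norm_num : (0 : ℝ) < 2)]
      linarith [h1 x, h1 (x + z), h1 (x - z)]
    have hK : lamK z = 1 / Real.pi ^ 2 * ‖z‖ ^ (-(4 : ℝ)) := lamK_eq_rpow (norm_pos_iff.1 hzpos)
    rw [indicator_of_mem hzc, hK]
    have h4 : 1 / Real.pi ^ 2 * ‖z‖ ^ (-(4 : ℝ)) * ‖(2 : ℝ) • g x - g (x + z) - g (x - z)‖ ≤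
        1 / Real.pi ^ 2 * ‖z‖ ^ (-(4 : ℝ)) * (4 * M₁) :=
      mul_le_mul_of_nonneg_left htri (mul_nonneg (by positivity) (Real.rpow_nonneg (norm_nonneg _) _))
    have h5 : 1 / Real.pi ^ 2 * ‖z‖ ^ (-(4 : ℝ)) * (4 * M₁) = 1 / Real.pi ^ 2 * (4 * M₁) * ‖z‖ ^ (-(4 : ℝ)) := by
      ring
    linarith [hn1 z]

/-- **`Λ` is differentiable and `DΛf = Λ(Df)`** (as an operator-valued integral) for a `C³` field with bounded
`f, Df, D²f, D³f`: differentiation under the integral sign (`hasFDerivAt_integral_of_dominated_of_fderiv_le`) with the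
`x`-uniform majorant `derivDom`. -/
theorem hasFDerivAt_fracLapHalf {f : EuclideanSpace ℝ (Fin 3) → EuclideanSpace ℝ (Fin 3)} (hf : ContDiff ℝ 3 f) {M₀ M₁ M₂ M₃ : ℝ}
    (h0 : ∀ y, ‖f y‖ ≤ M₀) (h1 : ∀ y, ‖fderiv ℝ f y‖ ≤ M₁) (h2 : ∀ y, ‖iteratedFDeriv ℝ 2 f y‖ ≤ M₂)
    (h3 : ∀ y, ‖iteratedFDeriv ℝ 3 f y‖ ≤ M₃) (x₀ : EuclideanSpace ℝ (Fin 3)) :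
    HasFDerivAt (fracLapHalf f)
      ((1 / 2 : ℝ) • ∫ z, lamK z • ((2 : ℝ) • fderiv ℝ f x₀ - fderiv ℝ f (x₀ + z) - fderiv ℝ f (x₀ - z))) x₀ := by
  set F : EuclideanSpace ℝ (Fin 3) → EuclideanSpace ℝ (Fin 3) → EuclideanSpace ℝ (Fin 3) := fun x z => lamK z • ((2 : ℝ) • f x - f (x + z) - f (x - z)) with hF
  set F' : EuclideanSpace ℝ (Fin 3) → EuclideanSpace ℝ (Fin 3) → (EuclideanSpace ℝ (Fin 3) →L[ℝ] EuclideanSpace ℝ (Fin 3)) := fun x z =>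
    lamK z • ((2 : ℝ) • fderiv ℝ f x - fderiv ℝ f (x + z) - fderiv ℝ f (x - z)) with hF'
  have hf2 : ContDiff ℝ 2 f := hf.of_le (by norm_cast)
  have hg2 : ContDiff ℝ 2 (fderiv ℝ f) := hf.fderiv_right (m := 2) (by norm_cast)
  have hgc : Continuous (fderiv ℝ f) := hg2.continuous
  have hd : Differentiable ℝ f := hf.differentiable (by norm_cast)
  have h3g : ∀ y, ‖iteratedFDeriv ℝ 2 (fderiv ℝ f) y‖ ≤ M₃ := fun y => by
    rw [norm_iteratedFDeriv_fderiv]; exact h3 y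
  have hint : ∀ x, Integrable (F x) := fun x => integrable_fracLapHalf_integrand_of_contDiff hf2 h0 h2 x
  have hkey : HasFDerivAt (fun x => ∫ z, F x z) (∫ z, F' x₀ z) x₀ := by
    refine hasFDerivAt_integral_of_dominated_of_fderiv_le (bound := derivDom M₁ M₃) (s := univ) univ_mem
      (Eventually.of_forall fun x => (hint x).aestronglyMeasurable) (hint x₀) ?_ ?_ (integrable_derivDom M₁ M₃) ?_
    · have hc : Continuous fun z : EuclideanSpace ℝ (Fin 3) =>
          (2 : ℝ) • fderiv ℝ f x₀ - fderiv ℝ f (x₀ + z) - fderiv ℝ f (x₀ - z) :=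
        (continuous_const.sub (hgc.comp (continuous_const.add continuous_id))).sub
          (hgc.comp (continuous_const.sub continuous_id))
      exact measurable_lamK.aestronglyMeasurable.smul hc.aestronglyMeasurable
    · exact ae_of_all _ fun z x _ => norm_integrand_le_derivDom hg2 h1 h3g x z
    · refine ae_of_all _ fun z x _ => ?_
      have ha : HasFDerivAt (fun x => f (x + z)) (fderiv ℝ f (x + z)) x := by
        have := (hd (x + z)).hasFDerivAt.comp x ((hasFDerivAt_id x).add_const z)
        simpa [Function.comp_def] using this
      have hb : HasFDerivAt (fun x => f (x - z)) (fderiv ℝ f (x - z)) x := by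
        have := (hd (x - z)).hasFDerivAt.comp x ((hasFDerivAt_id x).sub_const z)
        simpa [Function.comp_def] using this
      have hc : HasFDerivAt (fun x => (2 : ℝ) • f x) ((2 : ℝ) • fderiv ℝ f x) x := by
        have := (hd x).hasFDerivAt.const_smul (2 : ℝ)
        simpa [Pi.smul_def] using this
      exact ((hc.sub ha).sub hb).const_smul (lamK z)
  have h := hkey.const_smul (1 / 2 : ℝ)
  exact h.congr_of_eventuallyEq (Eventually.of_forall fun x => rfl)

/-- The derivative integrand is integrable (dominated by `derivDom`). -/
theorem integrable_derivIntegrand {f : EuclideanSpace ℝ (Fin 3) → EuclideanSpace ℝ (Fin 3)} (hf : ContDiff ℝ 3 f) {M₁ M₃ : ℝ}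
    (h1 : ∀ y, ‖fderiv ℝ f y‖ ≤ M₁) (h3 : ∀ y, ‖iteratedFDeriv ℝ 3 f y‖ ≤ M₃) (x : EuclideanSpace ℝ (Fin 3)) :
    Integrable (fun z => lamK z • ((2 : ℝ) • fderiv ℝ f x - fderiv ℝ f (x + z) - fderiv ℝ f (x - z))) := by
  have hg2 : ContDiff ℝ 2 (fderiv ℝ f) := hf.fderiv_right (m := 2) (by norm_cast)
  have h3g : ∀ y, ‖iteratedFDeriv ℝ 2 (fderiv ℝ f) y‖ ≤ M₃ := fun y => by
    rw [norm_iteratedFDeriv_fderiv]; exact h3 y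
  have hgc : Continuous (fderiv ℝ f) := hg2.continuous
  have hc : Continuous fun z : EuclideanSpace ℝ (Fin 3) => (2 : ℝ) • fderiv ℝ f x - fderiv ℝ f (x + z) - fderiv ℝ f (x - z) :=
    (continuous_const.sub (hgc.comp (continuous_const.add continuous_id))).sub
      (hgc.comp (continuous_const.sub continuous_id))
  exact (integrable_derivDom M₁ M₃).mono' (measurable_lamK.aestronglyMeasurable.smul hc.aestronglyMeasurable)
    (ae_of_all _ fun z => norm_integrand_le_derivDom hg2 h1 h3g x z)

/-- **`∂_e(Λf) = Λ(∂_e f)`** for a `C³` field with bounded `f, Df, D²f, D³f` and every direction `e`. -/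
theorem fderiv_fracLapHalf_apply {f : EuclideanSpace ℝ (Fin 3) → EuclideanSpace ℝ (Fin 3)} (hf : ContDiff ℝ 3 f) {M₀ M₁ M₂ M₃ : ℝ}
    (h0 : ∀ y, ‖f y‖ ≤ M₀) (h1 : ∀ y, ‖fderiv ℝ f y‖ ≤ M₁) (h2 : ∀ y, ‖iteratedFDeriv ℝ 2 f y‖ ≤ M₂)
    (h3 : ∀ y, ‖iteratedFDeriv ℝ 3 f y‖ ≤ M₃) (x e : EuclideanSpace ℝ (Fin 3)) :
    fderiv ℝ (fracLapHalf f) x e = fracLapHalf (fun y => fderiv ℝ f y e) x := by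
  rw [(hasFDerivAt_fracLapHalf hf h0 h1 h2 h3 x).fderiv, smul_apply,
    ContinuousLinearMap.integral_apply (integrable_derivIntegrand hf h1 h3 x) e]
  unfold fracLapHalf
  congr 1

/-- **`∂_e(Λ v(s)) = Λ(∂_e v(s))` for every door-class profile**, `s < 0`, direction `e` — the bounds on `v, ∇v, ∇²v, ∇³v`
come from the tree's all-orders scale-invariant package (`exists_classical_scaleInvariantBounds_of_class`). -/
theorem fderiv_fracLapHalf_slice_apply {C D : ℝ} {v : ℝ → EuclideanSpace ℝ (Fin 3) → EuclideanSpace ℝ (Fin 3)} (hrate : HasTypeITimeDecay C v)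
    (hdec : HasTypeIDecay D v) (hcont : ContinuousOn (uncurry v) (Iio (0 : ℝ) ×ˢ univ))
    (hmild : ∀ s t : ℝ, s < t → t < 0 → ∀ x,
      v t x = UnboundedOperators.heatExtension (v s) (t - s) x - oseenDuhamel 1 s v v t x)
    (hdiv : ∀ t < 0, VectorCalculus.IsDivFree (v t)) {s : ℝ} (hs : s < 0) (x e : EuclideanSpace ℝ (Fin 3)) :
    fderiv ℝ (fracLapHalf (v s)) x e = fracLapHalf (fun y => fderiv ℝ (v s) y e) x := by
  obtain ⟨Q, hsol, hSIB⟩ := exists_classical_scaleInvariantBounds_of_class hrate hdec hcont hmild hdiv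
  have hcd : ContDiff ℝ 3 (v s) :=
    (hsol.contDiff_velocity (show s ∈ Iio (0 : ℝ) from hs)).of_le (by norm_cast)
  have hsq : 0 < Real.sqrt (-s) := Real.sqrt_pos.2 (neg_pos.2 hs)
  -- the package at orders 0,1,2,3, specialised to the slice `s` (denominators ≥ powers of `√(−s)`)
  have hbd : ∀ n : ℕ, ∃ M : ℝ, ∀ y : EuclideanSpace ℝ (Fin 3), ‖iteratedFDeriv ℝ n (v s) y‖ ≤ M := by
    intro n
    obtain ⟨L, hL⟩ := hSIB n
    refine ⟨|L| / Real.sqrt (-s) ^ (1 + n), fun y => ?_⟩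
    have hden : 0 < (‖y‖ + Real.sqrt (-s)) ^ (1 + n) := by positivity
    calc ‖iteratedFDeriv ℝ n (v s) y‖ ≤ L / (‖y‖ + Real.sqrt (-s)) ^ (1 + n) := (hL s hs y).1
      _ ≤ |L| / (‖y‖ + Real.sqrt (-s)) ^ (1 + n) := div_le_div_of_nonneg_right (le_abs_self L) hden.le
      _ ≤ |L| / Real.sqrt (-s) ^ (1 + n) := by
          apply div_le_div_of_nonneg_left (abs_nonneg L) (by positivity)
          exact pow_le_pow_left₀ hsq.le (le_add_of_nonneg_left (norm_nonneg y)) _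
  obtain ⟨M₀, hM₀⟩ := hbd 0
  obtain ⟨M₁, hM₁⟩ := hbd 1
  obtain ⟨M₂, hM₂⟩ := hbd 2
  obtain ⟨M₃, hM₃⟩ := hbd 3
  refine fderiv_fracLapHalf_apply hcd (M₀ := M₀) (M₁ := M₁) (M₂ := M₂) (M₃ := M₃)
    (fun y => ?_) (fun y => ?_) hM₂ hM₃ x e
  · have := hM₀ y; rwa [norm_iteratedFDeriv_zero] at this
  · have := hM₁ y; rwa [norm_iteratedFDeriv_one] at this

/-! ## E8 — `div Λv = 0` FOR DIVERGENCE-FREE `v ∈ C³_b` (the gauge-freeness of F3's pressure flux `∫∇a_R·Λv = 0`;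
trace through the CLM-valued Bochner integral of E6). -/
/-- **`div Λf = 0`** for a divergence-free `C³` field with `f, Df, D²f, D³f` bounded: `div` is the trace of the
derivative, the derivative of `Λf` is the `CLM`-valued kernel integral of E6, the trace passes through the Bochner
integral, and `tr(2Df(x) − Df(x+z) − Df(x−z)) = 2div f(x) − div f(x+z) − div f(x−z) = 0`. -/
theorem isDivFree_fracLapHalf {f : EuclideanSpace ℝ (Fin 3) → EuclideanSpace ℝ (Fin 3)} (hf : ContDiff ℝ 3 f) {M₀ M₁ M₂ M₃ : ℝ}
    (h0 : ∀ y, ‖f y‖ ≤ M₀) (h1 : ∀ y, ‖fderiv ℝ f y‖ ≤ M₁) (h2 : ∀ y, ‖iteratedFDeriv ℝ 2 f y‖ ≤ M₂)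
    (h3 : ∀ y, ‖iteratedFDeriv ℝ 3 f y‖ ≤ M₃) (hdiv : VectorCalculus.IsDivFree f) :
    VectorCalculus.IsDivFree (fracLapHalf f) := by
  intro x
  have hd : ∀ y, (traceCLM : (EuclideanSpace ℝ (Fin 3) →L[ℝ] EuclideanSpace ℝ (Fin 3)) →L[ℝ] ℝ) (fderiv ℝ f y) = 0 := fun y => by
    rw [← divergence_eq_traceCLM]; exact hdiv y
  have hz : ∀ z, (traceCLM : (EuclideanSpace ℝ (Fin 3) →L[ℝ] EuclideanSpace ℝ (Fin 3)) →L[ℝ] ℝ)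
      (lamK z • ((2 : ℝ) • fderiv ℝ f x - fderiv ℝ f (x + z) - fderiv ℝ f (x - z))) = 0 := by
    intro z; rw [map_smul, map_sub, map_sub, map_smul, hd, hd, hd]; simp
  rw [divergence_eq_traceCLM, (hasFDerivAt_fracLapHalf hf h0 h1 h2 h3 x).fderiv, map_smul,
    ← (traceCLM : (EuclideanSpace ℝ (Fin 3) →L[ℝ] EuclideanSpace ℝ (Fin 3)) →L[ℝ] ℝ).integral_comp_comm (integrable_derivIntegrand hf h1 h3 x)]
  simp_rw [hz, integral_zero, smul_zero]

/-- **Door-class form**: every slice `Λ(v s)`, `s < 0`, of a door-class profile is divergence free (orders 0–3 of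
the scale-invariant package `exists_classical_scaleInvariantBounds_of_class` feed `isDivFree_fracLapHalf`). -/
theorem isDivFree_fracLapHalf_slice {C D : ℝ} {v : ℝ → EuclideanSpace ℝ (Fin 3) → EuclideanSpace ℝ (Fin 3)} (hrate : HasTypeITimeDecay C v)
    (hdec : HasTypeIDecay D v) (hcont : ContinuousOn (uncurry v) (Iio (0 : ℝ) ×ˢ univ))
    (hmild : ∀ s t : ℝ, s < t → t < 0 → ∀ x,
      v t x = UnboundedOperators.heatExtension (v s) (t - s) x - oseenDuhamel 1 s v v t x)
    (hdiv : ∀ t < 0, VectorCalculus.IsDivFree (v t)) {s : ℝ} (hs : s < 0) :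
    VectorCalculus.IsDivFree (fracLapHalf (v s)) := by
  obtain ⟨Q, hsol, hSIB⟩ := exists_classical_scaleInvariantBounds_of_class hrate hdec hcont hmild hdiv
  have hcd : ContDiff ℝ 3 (v s) :=
    (hsol.contDiff_velocity (show s ∈ Iio (0 : ℝ) from hs)).of_le (by norm_cast)
  have hsq : 0 < Real.sqrt (-s) := Real.sqrt_pos.2 (neg_pos.2 hs)
  have hbd : ∀ n : ℕ, ∃ M : ℝ, ∀ y : EuclideanSpace ℝ (Fin 3), ‖iteratedFDeriv ℝ n (v s) y‖ ≤ M := by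
    intro n
    obtain ⟨L, hL⟩ := hSIB n
    refine ⟨|L| / Real.sqrt (-s) ^ (1 + n), fun y => ?_⟩
    have hden : 0 < (‖y‖ + Real.sqrt (-s)) ^ (1 + n) := by positivity
    calc ‖iteratedFDeriv ℝ n (v s) y‖ ≤ L / (‖y‖ + Real.sqrt (-s)) ^ (1 + n) := (hL s hs y).1
      _ ≤ |L| / (‖y‖ + Real.sqrt (-s)) ^ (1 + n) := div_le_div_of_nonneg_right (le_abs_self L) hden.le
      _ ≤ |L| / Real.sqrt (-s) ^ (1 + n) := by
          apply div_le_div_of_nonneg_left (abs_nonneg L) (by positivity)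
          exact pow_le_pow_left₀ hsq.le (le_add_of_nonneg_left (norm_nonneg y)) _
  obtain ⟨M₀, hM₀⟩ := hbd 0
  obtain ⟨M₁, hM₁⟩ := hbd 1
  obtain ⟨M₂, hM₂⟩ := hbd 2
  obtain ⟨M₃, hM₃⟩ := hbd 3
  refine isDivFree_fracLapHalf hcd (M₀ := M₀) (M₁ := M₁) (M₂ := M₂) (M₃ := M₃)
    (fun y => ?_) (fun y => ?_) hM₂ hM₃ (hdiv s hs)
  · have := hM₀ y; rwa [norm_iteratedFDeriv_zero] at this
  · have := hM₁ y; rwa [norm_iteratedFDeriv_one] at this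

end Summit.NavierStokesRegularity.NavierStokesRegularity.Theorems.CriticalFluxDoorLambdaDeriv

end
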